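import Summits.CriticalPhenomena.PercolationContinuityZ3.Theorems.PercNearOneGluingNoHeavyQuantCatHullValueBoundS
import Summits.CriticalPhenomena.PercolationContinuityZ3.Theorems.PercNearOneGluingNoHeavyQuantCatHullTinySupport
import HarnessLib

/-!
# QUANT lane R8, T-DEC: PIECEWISE-AFFINE TABLES FOR THE OFFSET VALUE BOUND — real semantics `Tab.Z` of a rational cell table
# (monotone in the reach BY CONSTRUCTION), the exact `tip` / `final` / `shift` checks and their soundness

builds on p205010 (kernel theorem, internal audit signed; external expert review pending)

Support file (`--supports stmt-CriticalPhenomena-4575`), QUANT lane census seat prim-quant-census-2 (gen 78).  Definitions + theorems; standard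
axioms, no sorries.  This is the table-semantics layer of census-2 g78's kernel certificate for the corner (memo
`run/shared/lean/prim/quant/prim-quant-census-2-g78/BELLMAN-G78.md`): a `Tab` is a tensor grid of cells in (reach `G`, absolute mean `A`) with an
affine piece `a + b·G + c·A` per cell (rational data); its real semantics `Tab.Z G A` is the maximum over the `G`-cells `j ≤ k(G)` of the pieces read
at `(min G G_{j+1}, A)` — nondecreasing in `G` as soon as every `b ≥ 0` (`Tab.Z_mono`), which is the `mono` field of `CatValueBoundS` with no
further check; `Tab.Z_ge_own` (the own cell's piece is a lower bound) feeds the `tip`, `shift` and `leaf` checks.  Nothing here refers to a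
particular instance.  [this work].  Nothing here is cited as a published result.  The gluing rows served [cite: KozmaNitzan2024, Conjecture 3 (p. 15)];
product measure [cite: Grimmett1999, §1.3 p. 10].
-/

noncomputable section

open scoped BigOperators

namespace Summit.CriticalPhenomena.PercolationContinuityZ3.Theorems
namespace Quant
namespace LawDec

/-! ### Cell tables and their real semantics -/

/-- **a cell table**: `G`-breakpoints `gb` (increasing), `A`-breakpoints `ab` (increasing), and per cell `(k,l)` an affine piece `(a,b,c)`,
read as `a + b·G + c·A`. [this work] -/
structure Tab where
  gb : List ℚ
  ab : List ℚ
  co : List (List (ℚ × ℚ × ℚ))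

namespace Tab

/-- the piece of cell `(k,l)` (zero outside the table). [this work] -/
def pc (T : Tab) (k l : ℕ) : ℚ × ℚ × ℚ := (T.co.getD k []).getD l (0, 0, 0)

/-- value of an affine piece at a real point. [this work] -/
def ev (p : ℚ × ℚ × ℚ) (G A : ℝ) : ℝ := (p.1 : ℝ) + (p.2.1 : ℝ) * G + (p.2.2 : ℝ) * A

/-- cell index of a real coordinate for a breakpoint list `b₀ < b₁ < … < b_K`: the first `k` with `t < b_{k+1}` (last cell `K-1` if none),
by structural recursion (proof-friendly). [this work] -/
def idx : List ℚ → ℝ → ℕ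
  | _ :: b₁ :: b₂ :: rest, t => if t < (b₁ : ℝ) then 0 else idx (b₁ :: b₂ :: rest) t + 1
  | _, _ => 0

/-- the same index for a rational coordinate (computable twin of `idx`). [this work] -/
def idxQ : List ℚ → ℚ → ℕ
  | _ :: b₁ :: b₂ :: rest, t => if t < b₁ then 0 else idxQ (b₁ :: b₂ :: rest) t + 1
  | _, _ => 0

/-- `idx` at a rational point is its computable twin `idxQ`. [this work] -/
theorem idx_cast : ∀ (bs : List ℚ) (t : ℚ), idx bs (t : ℝ) = idxQ bs t
  | b₀ :: b₁ :: b₂ :: rest, t => by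
    simp only [idx, idxQ, Rat.cast_lt]
    split_ifs <;> simp [idx_cast (b₁ :: b₂ :: rest) t]
  | [], _ => rfl
  | [_], _ => rfl
  | [_, _], _ => rfl

/-- `idx` is monotone. [this work] -/
theorem idx_mono : ∀ (bs : List ℚ) {t t' : ℝ}, t ≤ t' → idx bs t ≤ idx bs t'
  | b₀ :: b₁ :: b₂ :: rest, t, t', h => by
    simp only [idx]
    by_cases h1 : t' < (b₁ : ℝ)
    · rw [if_pos (lt_of_le_of_lt h h1), if_pos h1]
    · rw [if_neg h1]
      by_cases h2 : t < (b₁ : ℝ)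
      · rw [if_pos h2]; exact Nat.zero_le _
      · rw [if_neg h2]; exact Nat.succ_le_succ (idx_mono (b₁ :: b₂ :: rest) h)
  | [], _, _, _ => le_rfl
  | [_], _, _, _ => le_rfl
  | [_, _], _, _, _ => le_rfl

/-- `idx` stays below the number of cells. [this work] -/
theorem idx_lt : ∀ (bs : List ℚ) (t : ℝ), 2 ≤ bs.length → idx bs t + 2 ≤ bs.length
  | b₀ :: b₁ :: b₂ :: rest, t, _ => by
    simp only [idx]
    split_ifs with h
    · simp
    · have := idx_lt (b₁ :: b₂ :: rest) t (by simp)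
      simp only [List.length_cons] at this ⊢; omega
  | [], _, h => by simp at h
  | [_], _, h => by simp at h
  | [_, _], _, _ => by simp [idx]

/-- lower cell boundary: `b_{idx t} ≤ t` provided `b₀ ≤ t`. [this work] -/
theorem getD_idx_le : ∀ (bs : List ℚ) (t : ℝ), ((bs.getD 0 0 : ℚ) : ℝ) ≤ t → ((bs.getD (idx bs t) 0 : ℚ) : ℝ) ≤ t
  | b₀ :: b₁ :: b₂ :: rest, t, h => by
    simp only [idx]
    split_ifs with h1
    · simpa using h
    · have := getD_idx_le (b₁ :: b₂ :: rest) t (by simpa using not_lt.1 h1)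
      simpa using this
  | [], _, h => by simpa [idx] using h
  | [_], _, h => by simpa [idx] using h
  | [_, _], _, h => by simpa [idx] using h

/-- upper cell boundary: `t ≤ b_{idx t + 1}` provided `t ≤ b_K` (the last breakpoint). [this work] -/
theorem le_getD_idx_succ : ∀ (bs : List ℚ) (t : ℝ), 2 ≤ bs.length → t ≤ ((bs.getLast?.getD 0 : ℚ) : ℝ) →
    t ≤ ((bs.getD (idx bs t + 1) 0 : ℚ) : ℝ)
  | b₀ :: b₁ :: b₂ :: rest, t, _, hlast => by
    simp only [idx]
    split_ifs with h1
    · simpa using h1.le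
    · have := le_getD_idx_succ (b₁ :: b₂ :: rest) t (by simp) (by simpa using hlast)
      simpa using this
  | [], _, h, _ => by simp at h
  | [_], _, h, _ => by simp at h
  | [b₀, b₁], t, _, hlast => by simpa [idx] using hlast

/-- the `j`-th term of the semantics: the piece of cell `(j, l)` read at `(min G G_{j+1}, A)`. [this work] -/
def term (T : Tab) (l : ℕ) (G A : ℝ) (j : ℕ) : ℝ := ev (T.pc j l) (min G ((T.gb.getD (j + 1) 1 : ℚ) : ℝ)) A

/-- running maximum of the terms `0..k`. [this work] -/
def zaux (T : Tab) (l : ℕ) (G A : ℝ) : ℕ → ℝ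
  | 0 => T.term l G A 0
  | k + 1 => max (T.zaux l G A k) (T.term l G A (k + 1))

/-- **real semantics of a table**: `Z G A = max_{j ≤ idx G} piece_{j, idx A}(min G G_{j+1}, A)`. [this work] -/
def Z (T : Tab) (G A : ℝ) : ℝ := T.zaux (idx T.ab A) G A (idx T.gb G)

/-- all `G`-slopes are nonnegative (checkable). [this work] -/
def slopesOK (T : Tab) : Bool := T.co.all fun row => row.all fun p => decide (0 ≤ p.2.1)

/-- a checked table has nonnegative `G`-slopes. [this work] -/
theorem pc_slope_nonneg {T : Tab} (h : T.slopesOK = true) (k l : ℕ) : 0 ≤ (T.pc k l).2.1 := by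
  unfold pc
  unfold slopesOK at h
  rw [List.all_eq_true] at h
  rcases Nat.lt_or_ge k T.co.length with hk | hk
  · have hrow := h _ (List.getElem_mem hk)
    rw [List.getD_eq_getElem _ _ hk, List.all_eq_true] at *
    rcases Nat.lt_or_ge l (T.co[k]).length with hl | hl
    · have := hrow _ (List.getElem_mem hl)
      rw [List.getD_eq_getElem _ _ hl]; simpa using this
    · rw [List.getD_eq_default _ _ hl]
  · rw [List.getD_eq_default _ _ hk]; simp

/-- each term is nondecreasing in `G` when the slopes are nonnegative. [this work] -/
theorem term_mono {T : Tab} (h : T.slopesOK = true) (l j : ℕ) {G G' : ℝ} (hG : G ≤ G') (A : ℝ) :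
    T.term l G A j ≤ T.term l G' A j := by
  unfold term ev
  have hb : (0 : ℝ) ≤ ((T.pc j l).2.1 : ℝ) := by exact_mod_cast pc_slope_nonneg h j l
  have hmin : min G ((T.gb.getD (j + 1) 1 : ℚ) : ℝ) ≤ min G' ((T.gb.getD (j + 1) 1 : ℚ) : ℝ) := min_le_min_right _ hG
  nlinarith [mul_le_mul_of_nonneg_left hmin hb]

/-- the running maximum is nondecreasing in `G`. [this work] -/
theorem zaux_mono_G {T : Tab} (h : T.slopesOK = true) (l : ℕ) {G G' : ℝ} (hG : G ≤ G') (A : ℝ) :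
    ∀ k, T.zaux l G A k ≤ T.zaux l G' A k
  | 0 => term_mono h l 0 hG A
  | k + 1 => max_le_max (zaux_mono_G h l hG A k) (term_mono h l (k + 1) hG A)

/-- the running maximum is nondecreasing in the number of terms. [this work] -/
theorem zaux_mono_k (T : Tab) (l : ℕ) (G A : ℝ) : ∀ {k k'}, k ≤ k' → T.zaux l G A k ≤ T.zaux l G A k'
  | k, 0, hk => by rw [Nat.le_zero.1 hk]
  | k, k' + 1, hk => by
    rcases Nat.lt_or_ge k (k' + 1) with hlt | hge
    · exact (zaux_mono_k T l G A (Nat.lt_succ_iff.1 hlt)).trans (le_max_left _ _)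
    · rw [le_antisymm hk hge]

/-- each term is below the running maximum. [this work] -/
theorem term_le_zaux (T : Tab) (l : ℕ) (G A : ℝ) : ∀ {j k}, j ≤ k → T.term l G A j ≤ T.zaux l G A k
  | j, 0, hj => by rw [Nat.le_zero.1 hj]; exact le_rfl
  | j, k + 1, hj => by
    rcases Nat.lt_or_ge j (k + 1) with hlt | hge
    · exact (term_le_zaux T l G A (Nat.lt_succ_iff.1 hlt)).trans (le_max_left _ _)
    · rw [le_antisymm hj hge]; exact le_max_right _ _

/-- **MONOTONICITY IN THE REACH, BY CONSTRUCTION**: nonnegative slopes ⟹ `Z G A ≤ Z G' A` for `G ≤ G'`. [this work] -/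
theorem Z_mono {T : Tab} (h : T.slopesOK = true) {G G' : ℝ} (hG : G ≤ G') (A : ℝ) : T.Z G A ≤ T.Z G' A :=
  (zaux_mono_G h _ hG A _).trans (zaux_mono_k T _ G' A (idx_mono T.gb hG))

/-- the own cell's term bounds `Z` from below. [this work] -/
theorem Z_ge_term (T : Tab) (G A : ℝ) : T.term (idx T.ab A) G A (idx T.gb G) ≤ T.Z G A :=
  term_le_zaux T _ G A le_rfl


/-! ### Structural checks, the `tip` check, and exact evaluation at rational points -/

/-- breakpoints increasing (checkable). [this work] -/
def sortedQ : List ℚ → Bool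
  | b₀ :: b₁ :: rest => decide (b₀ ≤ b₁) && sortedQ (b₁ :: rest)
  | _ => true

/-- consecutive breakpoints of an increasing list are ordered. [this work] -/
theorem getD_le_getD_succ : ∀ (bs : List ℚ), sortedQ bs = true → ∀ k, k + 2 ≤ bs.length → bs.getD k 0 ≤ bs.getD (k + 1) 0
  | b₀ :: b₁ :: rest, h, 0, _ => by
    simp only [sortedQ, Bool.and_eq_true, decide_eq_true_eq] at h; simpa using h.1
  | b₀ :: b₁ :: rest, h, k + 1, hk => by
    simp only [sortedQ, Bool.and_eq_true, decide_eq_true_eq] at h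
    have := getD_le_getD_succ (b₁ :: rest) h.2 k (by simp only [List.length_cons] at hk ⊢; omega)
    simpa using this
  | [], _, k, hk => by simp at hk
  | [_], _, k, hk => by simp at hk

/-- an affine function nonnegative at both ends of a segment is nonnegative on it. [folklore] -/
theorem affine_nonneg_of_ends {α β lo hi t : ℝ} (hlo : lo ≤ t) (hhi : t ≤ hi) (h0 : 0 ≤ α + β * lo) (h1 : 0 ≤ α + β * hi) :
    0 ≤ α + β * t := by
  rcases le_or_gt 0 β with hb | hb
  · nlinarith [mul_le_mul_of_nonneg_left hlo hb]
  · nlinarith [mul_le_mul_of_nonpos_left hhi hb.le]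

/-- **the `tip` check**: the bottom piece of every `G`-cell is nonnegative at `A = 0` at both cell ends. [this work] -/
def tipOK (T : Tab) : Bool :=
  (List.range (T.gb.length - 1)).all fun k =>
    decide (0 ≤ (T.pc k 0).1 + (T.pc k 0).2.1 * T.gb.getD k 0) && decide (0 ≤ (T.pc k 0).1 + (T.pc k 0).2.1 * T.gb.getD (k + 1) 0)

/-- well-formedness of a table (checkable): at least one `G`-cell, `G`-breakpoints increasing, `A`-breakpoints start at `0` with the first cell
nondegenerate. [this work] -/
def wf (T : Tab) : Bool :=
  decide (2 ≤ T.gb.length) && sortedQ T.gb && decide (2 ≤ T.ab.length) && decide (T.ab.getD 0 1 = 0) && decide (0 < T.ab.getD 1 0) && sortedQ T.ab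

/-- in a well-formed table the absolute mean `0` lies in the first `A`-cell. [this work] -/
theorem idx_ab_zero {T : Tab} (h : T.wf = true) : idx T.ab 0 = 0 := by
  unfold wf at h
  simp only [Bool.and_eq_true, decide_eq_true_eq] at h
  obtain ⟨⟨⟨⟨⟨_, _⟩, hl⟩, _⟩, h1⟩, _⟩ := h
  match hT : T.ab, hl, h1 with
  | a₀ :: a₁ :: a₂ :: rest, _, h1 => simp only [idx]; rw [if_pos]; simpa using h1
  | [_, _], _, _ => rfl

/-- **soundness of the `tip` check**: `0 ≤ Z G 0` on the `G`-range of the table. [this work] -/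
theorem Z_tip {T : Tab} (hw : T.wf = true) (ht : T.tipOK = true) {G : ℝ} (h0 : ((T.gb.getD 0 0 : ℚ) : ℝ) ≤ G) :
    0 ≤ T.Z G 0 := by
  have hw' := hw
  unfold wf at hw; simp only [Bool.and_eq_true, decide_eq_true_eq] at hw
  obtain ⟨⟨⟨⟨⟨hlen, hsort⟩, _⟩, _⟩, _⟩, _⟩ := hw
  refine le_trans ?_ (Z_ge_term T G 0)
  rw [idx_ab_zero hw']
  set k := idx T.gb G with hk
  have hk2 : k + 2 ≤ T.gb.length := idx_lt T.gb G hlen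
  unfold tipOK at ht; rw [List.all_eq_true] at ht
  have hkm : k ∈ List.range (T.gb.length - 1) := List.mem_range.2 (by omega)
  have := ht k hkm
  simp only [Bool.and_eq_true, decide_eq_true_eq] at this
  obtain ⟨e0, e1⟩ := this
  unfold term ev
  simp only [mul_zero, add_zero]
  have hlt : k + 1 < T.gb.length := by omega
  have eq1 : T.gb.getD (k + 1) 1 = T.gb.getD (k + 1) 0 := by
    rw [List.getD_eq_getElem _ _ hlt, List.getD_eq_getElem _ _ hlt]
  have lo : ((T.gb.getD k 0 : ℚ) : ℝ) ≤ min G ((T.gb.getD (k + 1) 1 : ℚ) : ℝ) := by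
    refine le_min (getD_idx_le T.gb G h0) ?_
    rw [eq1]; exact_mod_cast getD_le_getD_succ T.gb hsort k hk2
  have hi : min G ((T.gb.getD (k + 1) 1 : ℚ) : ℝ) ≤ ((T.gb.getD (k + 1) 0 : ℚ) : ℝ) := by
    rw [eq1]; exact min_le_right _ _
  have e0' : (0 : ℝ) ≤ ((T.pc k 0).1 : ℝ) + ((T.pc k 0).2.1 : ℝ) * ((T.gb.getD k 0 : ℚ) : ℝ) := by exact_mod_cast e0
  have e1' : (0 : ℝ) ≤ ((T.pc k 0).1 : ℝ) + ((T.pc k 0).2.1 : ℝ) * ((T.gb.getD (k + 1) 0 : ℚ) : ℝ) := by exact_mod_cast e1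
  exact affine_nonneg_of_ends lo hi e0' e1'

/-- rational twin of `ev`. [this work] -/
def evQ (p : ℚ × ℚ × ℚ) (G A : ℚ) : ℚ := p.1 + p.2.1 * G + p.2.2 * A
/-- rational twin of `term`. [this work] -/
def termQ (T : Tab) (l : ℕ) (G A : ℚ) (j : ℕ) : ℚ := evQ (T.pc j l) (min G (T.gb.getD (j + 1) 1)) A
/-- rational twin of `zaux`. [this work] -/
def zauxQ (T : Tab) (l : ℕ) (G A : ℚ) : ℕ → ℚ
  | 0 => T.termQ l G A 0
  | k + 1 => max (T.zauxQ l G A k) (T.termQ l G A (k + 1))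
/-- **exact evaluation of `Z` at a rational point** (computable). [this work] -/
def ZQ (T : Tab) (G A : ℚ) : ℚ := T.zauxQ (idxQ T.ab A) G A (idxQ T.gb G)

/-- `term` at a rational point is the cast of `termQ`. [this work] -/
theorem term_cast (T : Tab) (l : ℕ) (G A : ℚ) (j : ℕ) : T.term l (G : ℝ) (A : ℝ) j = ((T.termQ l G A j : ℚ) : ℝ) := by
  unfold term termQ ev evQ; push_cast; rfl
/-- `zaux` at a rational point is the cast of `zauxQ`. [this work] -/
theorem zaux_cast (T : Tab) (l : ℕ) (G A : ℚ) : ∀ k, T.zaux l (G : ℝ) (A : ℝ) k = ((T.zauxQ l G A k : ℚ) : ℝ)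
  | 0 => by unfold zaux zauxQ; exact term_cast T l G A 0
  | k + 1 => by unfold zaux zauxQ; rw [zaux_cast T l G A k, term_cast]; push_cast; rfl
/-- `Z` at a rational point is the cast of `ZQ`. [this work] -/
theorem Z_cast (T : Tab) (G A : ℚ) : T.Z (G : ℝ) (A : ℝ) = ((T.ZQ G A : ℚ) : ℝ) := by
  unfold Z ZQ; rw [idx_cast, idx_cast]; exact zaux_cast T _ G A _

end Tab

end LawDec
end Quant
end Summit.CriticalPhenomena.PercolationContinuityZ3.Theorems
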